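import Summits.QuantumFields.YangMills.Theorems.ColdStartUniversalityLatticeLangevinWilsonReversibleMeasurable
import Summits.QuantumFields.YangMills.Theorems.ColdStartUniversalityLatticeLangevinDynkinForward
import HarnessLib

/-!
# Route `ColdStartUniversality` (fixed-cut-off package): Dynkin's formula in KERNEL form and INFINITESIMAL INVARIANCE of the
# Wilson measure — `∫ 𝓛F dμ_{β'} = 0` for smooth cylinder observables

Helper file (seat `ym-line-csu-p1`, g15).  For the SU(2) lattice Langevin (SZZ) system at coupling `β'`, the coordinate
generator `𝓛F = Σ_i ∂_i f · b_i + ½ Σ_{ij} ∂_j ∂_i f · Σ_n σ_{in} σ_{jn}` of a `C³` compactly supported `f` of the real link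
coordinates (`F = f ∘ coords`; the `gen` of `dynkin_forward`, seat g7):

* `transitionKernel_dynkin` — Dynkin's formula read on any realising Markov kernel family:
  `κ_τ F (x) = F(x) + ∫₀^τ κ_r (𝓛F)(x) dr` (from `dynkin_forward` along the regular flow);
* ★ `integral_generator_wilson_eq_zero` — INFINITESIMAL INVARIANCE `∫ 𝓛F dμ_{β'} = 0`: integrate Dynkin against `μ_{β'}`,
  exchange with `∫₀^τ` (joint continuity of the kernel action, `continuous_transitionKernel_action`) and use the invariance of
  `μ_{β'}` under every `κ_r` (`integral_transitionKernel_integral_eq_wilson`, SZZ Lemma 3.3).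

SZZ (CMP 400 (2023) §3) write the generator `𝓛_L = Σ_e Δ_e + Σ_e ⟨∇𝒮_e, ∇_e⟩` and use `∫ 𝓛_L F dμ = 0` / `𝓔^L(F,G) = -∫ 𝓛_L F G dμ`
via integration by parts for Haar measure; here no integration by parts is used.  THEOREMS ONLY, no definition, no sorry.
RECORD-rung R3 plumbing (fixed cut-off); nothing here bears on the Yang–Mills mass gap.
-/

set_option autoImplicit false

noncomputable section

namespace Summit.QuantumFields.YangMills.Theorems.ColdStartUniversality

open MeasureTheory ProbabilityTheory Finset Filter Set
open scoped BigOperators NNReal ENNReal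
open Literature.Probability.Process Literature.MathematicalPhysics.QuantumFieldTheory
open Literature.MathematicalPhysics.QuantumLattice (fundamentalRep fundamentalLatticeRep continuous_fundamentalRep)

variable {L : ℕ} [NeZero L]

/-- **Dynkin's formula in kernel form** for the SU(2) SZZ system: for a `C³` compactly supported `f` of the real link
coordinates, any realising Markov kernel family `κ`, any start `x` and `τ ≥ 0`,
`∫ f∘coords d(κ_τ x) = f(coords x) + ∫₀^τ (∫ 𝓛f d(κ_r x)) dr`. [folklore] -/
theorem transitionKernel_dynkin (β' : ℝ)
    (κ : ℝ≥0 → Kernel (GaugeConfig 3 L (Matrix.specialUnitaryGroup (Fin 2) ℂ))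
      (GaugeConfig 3 L (Matrix.specialUnitaryGroup (Fin 2) ℂ))) [∀ t, IsMarkovKernel (κ t)]
    (hreal : ∀ (t : ℝ≥0) (x : GaugeConfig 3 L (Matrix.specialUnitaryGroup (Fin 2) ℂ))
        (Ω : Type) [MeasurableSpace Ω] (P : Measure Ω) [IsProbabilityMeasure P]
        (W : ℝ≥0 → Ω → (Edge 3 L × NoiseIdx 2 → ℝ)) (hW : IsFlatBrownian W P)
        (U : ℝ≥0 → Ω → GaugeConfig 3 L (Matrix.specialUnitaryGroup (Fin 2) ℂ)),
        (∀ ω, U 0 ω = x) →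
        (latticeLangevinDynamics (fundamentalLatticeRep 2) β').IsSolution (fundamentalRep (Fin 2))
          hW.natFiltration P W U →
        κ t x = P.map (U t))
    {f : (Edge 3 L × Fin 2 × Fin 2 × Bool → ℝ) → ℝ} (hf : ContDiff ℝ 3 f) (hfc : HasCompactSupport f)
    (x : GaugeConfig 3 L (Matrix.specialUnitaryGroup (Fin 2) ℂ)) {τ : ℝ} (hτ : 0 ≤ τ) :
    let coords : GaugeConfig 3 L (Matrix.specialUnitaryGroup (Fin 2) ℂ) → (Edge 3 L × Fin 2 × Fin 2 × Bool → ℝ) :=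
      fun V q => (fun z : ℂ => if q.2.2.2 then z.im else z.re)
        ((fundamentalRep (Fin 2) (V q.1) : Matrix (Fin 2) (Fin 2) ℂ) q.2.1 q.2.2.1)
    let gen : GaugeConfig 3 L (Matrix.specialUnitaryGroup (Fin 2) ℂ) → ℝ := fun V =>
      (∑ i : Edge 3 L × Fin 2 × Fin 2 × Bool, fderiv ℝ f (coords V) (Pi.single i 1) *
          (fun z : ℂ => if i.2.2.2 then z.im else z.re)
            ((latticeLangevinDynamics (fundamentalLatticeRep 2) β').drift
              (matrixConfig (fundamentalRep (Fin 2)) V) i.1 i.2.1 i.2.2.1) +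
      1 / 2 * ∑ i : Edge 3 L × Fin 2 × Fin 2 × Bool, ∑ j : Edge 3 L × Fin 2 × Fin 2 × Bool,
        fderiv ℝ (fun z => fderiv ℝ f z (Pi.single i 1)) (coords V) (Pi.single j 1) *
          ∑ n : Edge 3 L × NoiseIdx 2,
            (if n.1 = i.1 then (fun z : ℂ => if i.2.2.2 then z.im else z.re)
              ((latticeLangevinDynamics (fundamentalLatticeRep 2) β').noise
                (matrixConfig (fundamentalRep (Fin 2)) V) i.1 n.2 i.2.1 i.2.2.1) else 0) *
            (if n.1 = j.1 then (fun z : ℂ => if j.2.2.2 then z.im else z.re)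
              ((latticeLangevinDynamics (fundamentalLatticeRep 2) β').noise
                (matrixConfig (fundamentalRep (Fin 2)) V) j.1 n.2 j.2.1 j.2.2.1) else 0))
    ∫ y, f (coords y) ∂(κ τ.toNNReal x) = f (coords x) + ∫ r in (0 : ℝ)..τ, (∫ y, gen y ∂(κ r.toNNReal x)) := by
  intro coords gen
  classical
  haveI := secondCountableTopology_su2
  haveI := borelSpace_config L
  have hco : Continuous coords := continuous_coords (L := L)
  have hFc : Continuous fun V => f (coords V) := hf.continuous.comp hco
  have hgenc : Continuous gen := continuous_generator (L := L) β' (hf.of_le (by norm_num))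
  -- the regular flow on the product Wiener space realises `κ`
  haveI := isProbabilityMeasure_piWiener (Edge 3 L × NoiseIdx 2)
  have hWc := isFlatBrownian_piWiener 3 L (NoiseIdx 2)
  obtain ⟨X, GX, hX, hXm, -, -, -⟩ := exists_regularFlow L β' hWc
  have hPX : ∀ (s : ℝ≥0) {G : GaugeConfig 3 L (Matrix.specialUnitaryGroup (Fin 2) ℂ) → ℝ}, Continuous G →
      ∫ y, G y ∂(κ s x) = ∫ ω, G (X x s ω) ∂(Measure.pi fun _ : Edge 3 L × NoiseIdx 2 => preWienerMeasure) := by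
    intro s G hG
    have hm : Measurable (X x s) := ((hX x).2.adapted s).mono (hWc.natFiltration.le s) le_rfl
    rw [hreal s x _ _ _ hWc (X x) (hX x).1 (hX x).2, integral_map hm.aemeasurable hG.aestronglyMeasurable]
  -- Dynkin along the flow
  have hD := dynkin_forward (L := L) β' hWc X hX hXm x hf hfc
  obtain ⟨-, -, hD3⟩ := hD
  have h := hD3 τ hτ
  rw [hPX _ hFc]
  rw [h]
  congr 1
  refine intervalIntegral.integral_congr fun r _ => ?_
  exact (hPX _ hgenc).symm

/-- ★ **Infinitesimal invariance of the Wilson measure under the SZZ generator**: `∫ 𝓛F dμ_{β'} = 0` for every `C³` compactly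
supported `f` of the real link coordinates (`𝓛F` = the coordinate generator of `dynkin_forward`).  Integrate Dynkin's formula
against `μ_{β'}`, exchange the integrals and use the invariance of `μ_{β'}` under each `κ_r` (SZZ Lemma 3.3); no integration by
parts. [cite: ShenZhuZhu2022, §3 (generator 𝓛_L and Lemma 3.3, p. 13)] -/
theorem integral_generator_wilson_eq_zero (L : ℕ) [NeZero L] (β' : ℝ)
    {f : (Edge 3 L × Fin 2 × Fin 2 × Bool → ℝ) → ℝ} (hf : ContDiff ℝ 3 f) (hfc : HasCompactSupport f) :
    let coords : GaugeConfig 3 L (Matrix.specialUnitaryGroup (Fin 2) ℂ) → (Edge 3 L × Fin 2 × Fin 2 × Bool → ℝ) :=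
      fun V q => (fun z : ℂ => if q.2.2.2 then z.im else z.re)
        ((fundamentalRep (Fin 2) (V q.1) : Matrix (Fin 2) (Fin 2) ℂ) q.2.1 q.2.2.1)
    let gen : GaugeConfig 3 L (Matrix.specialUnitaryGroup (Fin 2) ℂ) → ℝ := fun V =>
      (∑ i : Edge 3 L × Fin 2 × Fin 2 × Bool, fderiv ℝ f (coords V) (Pi.single i 1) *
          (fun z : ℂ => if i.2.2.2 then z.im else z.re)
            ((latticeLangevinDynamics (fundamentalLatticeRep 2) β').drift
              (matrixConfig (fundamentalRep (Fin 2)) V) i.1 i.2.1 i.2.2.1) +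
      1 / 2 * ∑ i : Edge 3 L × Fin 2 × Fin 2 × Bool, ∑ j : Edge 3 L × Fin 2 × Fin 2 × Bool,
        fderiv ℝ (fun z => fderiv ℝ f z (Pi.single i 1)) (coords V) (Pi.single j 1) *
          ∑ n : Edge 3 L × NoiseIdx 2,
            (if n.1 = i.1 then (fun z : ℂ => if i.2.2.2 then z.im else z.re)
              ((latticeLangevinDynamics (fundamentalLatticeRep 2) β').noise
                (matrixConfig (fundamentalRep (Fin 2)) V) i.1 n.2 i.2.1 i.2.2.1) else 0) *
            (if n.1 = j.1 then (fun z : ℂ => if j.2.2.2 then z.im else z.re)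
              ((latticeLangevinDynamics (fundamentalLatticeRep 2) β').noise
                (matrixConfig (fundamentalRep (Fin 2)) V) j.1 n.2 j.2.1 j.2.2.1) else 0))
    ∫ V, gen V ∂(wilsonMeasure (d := 3) (L := L) (fundamentalRep (Fin 2)) β') = 0 := by
  intro coords gen
  classical
  haveI := secondCountableTopology_su2
  haveI := borelSpace_config L
  set μ : Measure (GaugeConfig 3 L (Matrix.specialUnitaryGroup (Fin 2) ℂ)) :=
    wilsonMeasure (d := 3) (L := L) (fundamentalRep (Fin 2)) β' with hμ
  haveI : IsProbabilityMeasure μ :=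
    isProbabilityMeasure_wilsonMeasure (d := 3) (L := L) (fundamentalRep (Fin 2)) (continuous_fundamentalRep (Fin 2)) β'
  obtain ⟨κ, hκ, -, hreal⟩ := exists_transitionKernel L β'
  haveI := hκ
  have hco : Continuous coords := continuous_coords (L := L)
  have hFc : Continuous fun V => f (coords V) := hf.continuous.comp hco
  have hgenc : Continuous gen := continuous_generator (L := L) β' (hf.of_le (by norm_num))
  obtain ⟨MF, -, hMF⟩ := exists_abs_le_of_continuous hFc
  obtain ⟨Mg, -, hMg⟩ := exists_abs_le_of_continuous hgenc
  -- invariance on the two continuous observables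
  have hinvF : ∫ x, (∫ y, f (coords y) ∂(κ 1 x)) ∂μ = ∫ x, f (coords x) ∂μ :=
    integral_transitionKernel_integral_eq_wilson (L := L) β' κ hreal 1 hFc.measurable ⟨MF, hMF⟩
  have hinvg : ∀ r : ℝ, ∫ x, (∫ y, gen y ∂(κ r.toNNReal x)) ∂μ = ∫ x, gen x ∂μ := fun r =>
    integral_transitionKernel_integral_eq_wilson (L := L) β' κ hreal r.toNNReal hgenc.measurable ⟨Mg, hMg⟩
  -- Dynkin at time `1`, pointwise in the start
  have hDyn : ∀ x, ∫ y, f (coords y) ∂(κ 1 x) = f (coords x) + ∫ r in (0 : ℝ)..1, (∫ y, gen y ∂(κ r.toNNReal x)) := by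
    intro x
    have h := transitionKernel_dynkin (L := L) β' κ hreal hf hfc x zero_le_one
    rw [Real.toNNReal_one] at h
    exact h
  -- the time integrand is jointly continuous in `(r, x)`
  have hG : Continuous (Function.uncurry fun (r : ℝ) (x : GaugeConfig 3 L (Matrix.specialUnitaryGroup (Fin 2) ℂ)) =>
      ∫ y, gen y ∂(κ r.toNNReal x)) :=
    (continuous_transitionKernel_action β' κ hreal hgenc).comp
      ((continuous_real_toNNReal.comp continuous_fst).prodMk continuous_snd)
  have hG' : Continuous (Function.uncurry fun (x : GaugeConfig 3 L (Matrix.specialUnitaryGroup (Fin 2) ℂ)) (r : ℝ) =>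
      ∫ y, gen y ∂(κ r.toNNReal x)) := hG.comp continuous_swap
  have hI : Continuous fun x : GaugeConfig 3 L (Matrix.specialUnitaryGroup (Fin 2) ℂ) =>
      ∫ r in (0 : ℝ)..1, (∫ y, gen y ∂(κ r.toNNReal x)) :=
    intervalIntegral.continuous_parametric_intervalIntegral_of_continuous' hG' 0 1
  -- integrate Dynkin against `μ`
  have e1 : ∫ x, (∫ y, f (coords y) ∂(κ 1 x)) ∂μ = (∫ x, f (coords x) ∂μ) + ∫ x, (∫ r in (0 : ℝ)..1, (∫ y, gen y ∂(κ r.toNNReal x))) ∂μ := by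
    rw [← integral_add (integrable_of_continuous_of_compactSpace hFc μ) (integrable_of_continuous_of_compactSpace hI μ)]
    exact integral_congr_ae (Eventually.of_forall hDyn)
  have e2 : ∫ x, (∫ r in (0 : ℝ)..1, (∫ y, gen y ∂(κ r.toNNReal x))) ∂μ = ∫ r in (0 : ℝ)..1, (∫ x, gen x ∂μ) := by
    rw [integral_intervalIntegral_swap_of_continuous μ hG zero_le_one]
    exact intervalIntegral.integral_congr fun r _ => hinvg r
  have e3 : ∫ r in (0 : ℝ)..1, (∫ x, gen x ∂μ) = ∫ x, gen x ∂μ := by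
    rw [intervalIntegral.integral_const, sub_zero, one_smul]
  have h := e1
  rw [hinvF, e2, e3] at h
  linarith

end Summit.QuantumFields.YangMills.Theorems.ColdStartUniversality

end
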